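import Summits.CriticalPhenomena.PercolationContinuityZ3.Theorems.PercNearOneGluingNoHeavyQuantBlockCombRootContraction
import Summits.CriticalPhenomena.PercolationContinuityZ3.Theorems.PercNearOneGluingNoHeavyQuantBlockCombBlockStarRow
import HarnessLib

/-!
# QUANT lane R8, FAR on trees: the ROOT SPLIT of a block-comb, FAR when every private gate is at least the LAST chain gate,
# and every TWO-PLATEAU block-comb with ONE root block (canonical model)

builds on p205010 (kernel theorem, internal audit signed; external expert review pending)

Support file (`--supports stmt-CriticalPhenomena-4575`), QUANT lane lead (gen 13); memo
`run/shared/lean/prim/quant/prim-quant-lead-g13/LEAD-NOTES-G13.md` N24 (2)(7).  Theorems only (local notation, no definitions),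
no sorries, standard axioms.  Model and notation: `…QuantBlockCombMergeModel.lean`; tools: `…QuantBlockCombRootContraction.lean`
(root contraction, the tied theorem) and `…QuantBlockCombBlockStarRow.lean` (the canonical `D = 1` block-star row under the mean hypothesis).

* `Quant.BlockComb.tail_succ_ge_rootGate_mul` — **ROOT SPLIT** (the `U`-split at the first chain gate, no hypothesis on the root mass):
  `TAIL[D+1, q] ≥ q 0 · TAIL[D, q∘succ, lv − 1]` (the dropped term `(1 − q 0)·P(root blobs alone cross)` is nonnegative; with root mass
  `≤ j` it vanishes and this is `tail_contract_root`).
* `Quant.BlockComb.tail_ge_of_gates_ge_lastGate` — **THEOREM (FAR when every private gate is at least the last chain gate).**  Chain of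
  `D+1` gates, levels `≤ D+1`, terminal-level blobs sure, every other blob with private gate `g k ≥ q D` (in gate coordinates: every blob at
  least as reliable, GIVEN its level is reached, as the terminal is given the last plateau is reached — `g_k ≥ x/W_L`), and the budget
  `2j < Σ_k a k·marginal k` (`= EN`); then `∏_{i ≤ D} q i ≤ TAIL`.  Proof: split the root `D` times (each split keeps the hypotheses and can
  only raise the mean) down to the `D = 1` block-star row `tail_one_ge_rootGate_of_mean`.  No class, root-mass or common-gate hypothesis:
  this is a budget-binding family of every depth (e.g. a reliable root block over deep tied plateaus with `11j < B + c ≤ 19j` in the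
  example of N24 (7)), disjoint in general from the class `(Σa)·x > 2j` and from the strong regime.
* `Quant.BlockComb.tail_ge_of_contracted_class` — **THEOREM (contracted class).**  `2j·q 0 < (Σ a)·x` and root blobs with `x ≤ q 0·g k`
  (plus the usual `x ≤` marginals) ⟹ `x ≤ TAIL` — the class condition tested AFTER contracting the first chain gate (root split +
  `tail_ge_of_class`); `EN > 2j` is not even assumed.
* `Quant.BlockComb.tail_two_ge_of_commonRoot` — **THEOREM (the complete two-plateau single-root-block family).**  Two chain gates; root
  blobs of a common gate `ρ ≥ x := q 0·q 1` and total size `≤ j`; level-`1` blobs tied (gate `q 1`); level-`2` blobs sure (the terminal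
  block); `EN = ρ·(root mass) + x·(rest) > 2j` ⟹ `x ≤ TAIL`, with NO regime restriction: `ρ·q 0 ≤ x` is the tied theorem
  (`tail_ge_of_commonRoot_tied_of_budget`, contraction to the all-tied instance + the class theorem), and `x < ρ·q 0` (root block MORE
  reliable than the deep private gate `q 1`) is `tail_ge_of_gates_ge_lastGate`.  Core (α) of LEAD-NOTES-G12 N23 (2g) with one root block,
  any number of tied deep blobs — the family of N23 (2f)(iii)'s interior minima.
Honest scope: root blocks LIGHTER than the last chain gate with several different gates (β), untied-but-not-sure blobs mixed with
lighter root blocks, are NOT covered (LEAD-NOTES-G13 N24 (2) 'limit', (4)).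
-/

namespace Summit.CriticalPhenomena.PercolationContinuityZ3.Theorems

namespace Quant

namespace BlockComb

open Finset

variable {κ : Type*} [Fintype κ] [DecidableEq κ]

/-- product-Bernoulli weight of the set `S` of open blob gates -/
local notation3 "wt[" g ", " S "]" => ∏ k, (if k ∈ (S : Finset κ) then (g : κ → ℝ) k else 1 - (g : κ → ℝ) k)

/-- probability that the chain `q` of length `D` is open exactly to depth `i` -/
local notation3 "pd[" D ", " q ", " i "]" =>
  (∏ i' ∈ Finset.range (i : ℕ), (q : ℕ → ℝ) i') * (if (i : ℕ) < (D : ℕ) then 1 - (q : ℕ → ℝ) i else 1)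

/-- mass counted at depth `i` in blob configuration `S` -/
local notation3 "mass[" lv ", " a ", " i ", " S "]" =>
  ∑ k ∈ (S : Finset κ).filter (fun k => (lv : κ → ℕ) k ≤ (i : ℕ)), ((a : κ → ℕ) k : ℕ)

/-- the tail `P(N ≥ j+1)` of the block-comb count, as an explicit finite sum -/
local notation3 "TAIL[" D ", " q ", " lv ", " a ", " g ", " j "]" =>
  ∑ i ∈ Finset.range ((D : ℕ) + 1), pd[D, q, i] *
    ∑ S : Finset κ, wt[g, S] * (if (j : ℕ) + 1 ≤ mass[lv, a, i, S] then (1 : ℝ) else 0)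

/-! ### 1. The root split -/

/-- **Root split.**  For chain gates in `[0,1]` and private gates in `[0,1]`: `TAIL[D+1, q] ≥ q 0 · TAIL[D, q ∘ succ]` with all levels
lowered by one (natural subtraction keeps the root blobs at level `0`).  The difference is `(1 − q 0)·Σ_S wt S·𝟙[root mass of S ≥ j+1] ≥ 0`
(the chain closed at its first gate, root blobs alone crossing). [this work] -/
theorem tail_succ_ge_rootGate_mul (D : ℕ) (q : ℕ → ℝ) (hq : ∀ i, 0 ≤ q i ∧ q i ≤ 1) (lv : κ → ℕ) (a : κ → ℕ)
    (g : κ → ℝ) (hg : ∀ k, 0 ≤ g k ∧ g k ≤ 1) (j : ℕ) :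
    q 0 * TAIL[D, (fun i => q (i + 1)), (fun k => lv k - 1), a, g, j] ≤ TAIL[D + 1, q, lv, a, g, j] := by
  conv_rhs => rw [Finset.sum_range_succ']
  -- the depth-`0` term is nonnegative
  have h0 : 0 ≤ pd[D + 1, q, 0] * ∑ S : Finset κ, wt[g, S] * (if j + 1 ≤ mass[lv, a, 0, S] then (1 : ℝ) else 0) :=
    mul_nonneg (pd_nonneg (D + 1) q hq 0)
      (Finset.sum_nonneg fun S _ => mul_nonneg (wt_nonneg g hg S) (by split_ifs <;> norm_num))
  -- the other terms are `q 0 ·` the contracted ones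
  have hrest : ∑ i ∈ Finset.range (D + 1), pd[D + 1, q, i + 1] *
      ∑ S : Finset κ, wt[g, S] * (if j + 1 ≤ mass[lv, a, i + 1, S] then (1 : ℝ) else 0) =
        q 0 * TAIL[D, (fun i => q (i + 1)), (fun k => lv k - 1), a, g, j] := by
    rw [Finset.mul_sum]
    refine Finset.sum_congr rfl fun i hi => ?_
    have hpd : pd[D + 1, q, i + 1] = q 0 * pd[D, (fun i => q (i + 1)), i] := by
      show (∏ i' ∈ Finset.range (i + 1), q i') * (if i + 1 < D + 1 then 1 - q (i + 1) else 1) =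
        q 0 * ((∏ i' ∈ Finset.range i, q (i' + 1)) * (if i < D then 1 - q (i + 1) else 1))
      rw [Finset.prod_range_succ']
      by_cases hi' : i < D
      · rw [if_pos hi', if_pos (by omega)]; ring
      · rw [if_neg hi', if_neg (by omega)]; ring
    have hmass : ∀ S : Finset κ, mass[lv, a, i + 1, S] = mass[(fun k => lv k - 1), a, i, S] := by
      intro S
      refine Finset.sum_congr ?_ fun _ _ => rfl
      ext k
      simp only [Finset.mem_filter]
      constructor
      · rintro ⟨hk, hle⟩; exact ⟨hk, by omega⟩
      · rintro ⟨hk, hle⟩; exact ⟨hk, by omega⟩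
    rw [hpd, mul_assoc]
    congr 1
    congr 1
    exact Finset.sum_congr rfl fun S _ => by rw [hmass S]
  rw [hrest]
  linarith

/-! ### 2. FAR when every private gate is at least the last chain gate -/

omit [DecidableEq κ] in
/-- The mean splits off the root: lowering every level by one and dropping the first chain gate multiplies each non-root marginal
by `1/q 0 ≥ 1`, so the mean of the contracted instance is at least the original mean. [this work] -/
theorem sum_marg_le_contracted (q : ℕ → ℝ) (hq : ∀ i, 0 ≤ q i ∧ q i ≤ 1) (lv : κ → ℕ) (a : κ → ℕ)
    (g : κ → ℝ) (hg : ∀ k, 0 ≤ g k ∧ g k ≤ 1) :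
    ∑ k, (a k : ℝ) * ((∏ i ∈ Finset.range (lv k), q i) * g k) ≤
      ∑ k, (a k : ℝ) * ((∏ i ∈ Finset.range (lv k - 1), q (i + 1)) * g k) := by
  refine Finset.sum_le_sum fun k _ => mul_le_mul_of_nonneg_left ?_ (Nat.cast_nonneg _)
  refine mul_le_mul_of_nonneg_right ?_ (hg k).1
  by_cases hk : lv k = 0
  · rw [hk]; simp
  · obtain ⟨n, hn⟩ := Nat.exists_eq_succ_of_ne_zero hk
    rw [hn, prefixProd_succ, Nat.succ_sub_one]
    have hP : 0 ≤ ∏ i ∈ Finset.range n, q (i + 1) := Finset.prod_nonneg fun i _ => (hq (i + 1)).1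
    calc q 0 * ∏ i ∈ Finset.range n, q (i + 1) ≤ 1 * ∏ i ∈ Finset.range n, q (i + 1) :=
        mul_le_mul_of_nonneg_right (hq 0).2 hP
      _ = ∏ i ∈ Finset.range n, q (i + 1) := one_mul _

/-- **THEOREM (FAR when every private gate is at least the last chain gate, canonical model, every depth).**  Chain gates
`q 0, …, q D ∈ [0,1]`, blobs with levels `≤ D+1` and private gates in `[0,1]`; the terminal-level blobs (level `D+1`) are sure; every
other blob has `g k ≥ q D`; and `2j < Σ_k a k·(∏_{i<lv k} q i)·g k` (the mean).  Then `∏_{i ≤ D} q i ≤ TAIL[D+1, q, lv, a, g, j]` — FAR with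
`x` = the terminal marginal (every other marginal is at least `x` by `g k ≥ q D`).  Proof: induction on `D` by the root split; base = the
block-star row `tail_one_ge_rootGate_of_mean`. [this work] -/
theorem tail_ge_of_gates_ge_lastGate : ∀ (D : ℕ) (q : ℕ → ℝ), (∀ i, 0 ≤ q i ∧ q i ≤ 1) →
    ∀ (lv : κ → ℕ), (∀ k, lv k ≤ D + 1) → ∀ (a : κ → ℕ) (g : κ → ℝ), (∀ k, 0 ≤ g k ∧ g k ≤ 1) → ∀ (j : ℕ),
    (∀ k, lv k ≤ D → q D ≤ g k) → (∀ k, lv k = D + 1 → g k = 1) →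
    (2 * j : ℝ) < ∑ k, (a k : ℝ) * ((∏ i ∈ Finset.range (lv k), q i) * g k) →
    ∏ i ∈ Finset.range (D + 1), q i ≤ TAIL[D + 1, q, lv, a, g, j] := by
  intro D
  induction D with
  | zero =>
    intro q hq lv hlv a g hg j hgate hsure hbudget
    rw [Finset.prod_range_one]
    refine tail_one_ge_rootGate_of_mean q (hq 0) lv (fun k => by have := hlv k; omega) a g hg
      (fun k hk => hgate k (Nat.le_zero.2 hk)) (fun k hk => hsure k (by have := hlv k; omega)) j ?_
    -- the mean in filter form
    have hsplit : ∑ k, (a k : ℝ) * ((∏ i ∈ Finset.range (lv k), q i) * g k) =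
        ∑ k ∈ Finset.univ.filter (fun k => lv k = 0), (a k : ℝ) * g k +
          q 0 * ∑ k ∈ Finset.univ.filter (fun k => lv k ≠ 0), (a k : ℝ) := by
      rw [Finset.sum_filter, Finset.sum_filter, Finset.mul_sum, ← Finset.sum_add_distrib]
      refine Finset.sum_congr rfl fun k _ => ?_
      by_cases hk : lv k = 0
      · rw [if_pos hk, if_neg (not_not.2 hk), hk, Finset.prod_range_zero, one_mul, mul_zero, add_zero]
      · have h1 : lv k = 1 := by have := hlv k; omega
        rw [if_neg hk, if_pos hk, h1, Finset.prod_range_one, hsure k h1]; ring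
    rw [← hsplit]; exact hbudget
  | succ D ih =>
    intro q hq lv hlv a g hg j hgate hsure hbudget
    -- split the root and apply the induction hypothesis to the contracted instance
    have hq' : ∀ i, 0 ≤ q (i + 1) ∧ q (i + 1) ≤ 1 := fun i => hq (i + 1)
    have hih := ih (fun i => q (i + 1)) hq' (fun k => lv k - 1) (fun k => by have := hlv k; omega) a g hg j
      (fun k hk => hgate k (by omega)) (fun k hk => hsure k (by have := hlv k; omega))
      (hbudget.trans_le (sum_marg_le_contracted q hq lv a g hg))
    calc ∏ i ∈ Finset.range (D + 1 + 1), q i = q 0 * ∏ i ∈ Finset.range (D + 1), q (i + 1) := prefixProd_succ q (D + 1)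
      _ ≤ q 0 * TAIL[D + 1, (fun i => q (i + 1)), (fun k => lv k - 1), a, g, j] := mul_le_mul_of_nonneg_left hih (hq 0).1
      _ ≤ TAIL[D + 1 + 1, q, lv, a, g, j] := tail_succ_ge_rootGate_mul (D + 1) q hq lv a g hg j

/-! ### 2b. The class condition may be tested after contracting the first chain gate -/

/-- **THEOREM (contracted class).**  If every live ROOT blob satisfies `x ≤ q 0·g k` (it stays at least as likely as the terminal after
the first chain gate is contracted), every live marginal is `≥ x`, and `2j·q 0 < (Σ a)·x` (the CLASS condition of the contracted
instance, weaker than `(Σ a)·x > 2j` by the factor `q 0`), then `x ≤ TAIL[D+1, q]`.  Proof: root split + `tail_ge_of_class` for the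
contracted instance at `x/q 0`.  (Iterating: the class condition may be tested after contracting any number of top chain gates, as
long as the blobs above the cut are at least as reliable as the contracted terminal.)  Note that `EN > 2j` is NOT assumed. [this work] -/
theorem tail_ge_of_contracted_class (D : ℕ) (q : ℕ → ℝ) (hq : ∀ i, 0 ≤ q i ∧ q i ≤ 1) (lv : κ → ℕ) (a : κ → ℕ)
    (g : κ → ℝ) (hg : ∀ k, 0 ≤ g k ∧ g k ≤ 1) (j : ℕ) (hlv : ∀ k, 0 < a k → lv k ≤ D + 1) (x : ℝ)
    (hx : ∀ k, 0 < a k → x ≤ (∏ i ∈ Finset.range (lv k), q i) * g k)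
    (hroot : ∀ k, 0 < a k → lv k = 0 → x ≤ q 0 * g k)
    (hclass : (2 * j : ℝ) * q 0 < (∑ k', (a k' : ℝ)) * x) (hne : ∃ k, 0 < a k) :
    x ≤ TAIL[D + 1, q, lv, a, g, j] := by
  rcases (hq 0).1.lt_or_eq with hq0 | hq0
  · -- `q 0 > 0`: the contracted instance is in the class at `x / q 0`
    have hx' : ∀ k, 0 < a k → x / q 0 ≤ (∏ i ∈ Finset.range (lv k - 1), q (i + 1)) * g k := by
      intro k hk
      rw [div_le_iff₀ hq0]
      by_cases hk0 : lv k = 0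
      · rw [hk0]
        have h := hroot k hk hk0
        simpa [mul_comm] using h
      · obtain ⟨n, hn⟩ := Nat.exists_eq_succ_of_ne_zero hk0
        have h := hx k hk
        rw [hn, prefixProd_succ] at h
        rw [hn, Nat.succ_sub_one]
        linarith [h]
    have hclass' : (2 * j : ℝ) < (∑ k', (a k' : ℝ)) * (x / q 0) := by
      rw [← mul_div_assoc, lt_div_iff₀ hq0]; exact hclass
    have h := tail_ge_of_class D (fun i => q (i + 1)) (fun i => hq (i + 1)) (fun k => lv k - 1) a g hg j
      (fun k hk => by have := hlv k hk; omega) (x / q 0) hx' hclass' hne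
    calc x = q 0 * (x / q 0) := by field_simp
      _ ≤ q 0 * TAIL[D, (fun i => q (i + 1)), (fun k => lv k - 1), a, g, j] := mul_le_mul_of_nonneg_left h (hq 0).1
      _ ≤ TAIL[D + 1, q, lv, a, g, j] := tail_succ_ge_rootGate_mul D q hq lv a g hg j
  · -- `q 0 = 0`: then `x ≤ 0 ≤ TAIL`
    obtain ⟨k, hk⟩ := hne
    have hx0 : x ≤ 0 := by
      by_cases hk0 : lv k = 0
      · have h := hroot k hk hk0
        rw [← hq0, zero_mul] at h
        exact h
      · obtain ⟨n, hn⟩ := Nat.exists_eq_succ_of_ne_zero hk0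
        have h := hx k hk
        rw [hn, prefixProd_succ, ← hq0, zero_mul, zero_mul] at h
        exact h
    exact hx0.trans (tail_nonneg (D + 1) q hq lv a g hg j)

/-! ### 3. The complete two-plateau family with one root block -/

/-- Prefix product over the first two chain gates. [folklore] -/
theorem prefixProd_two (q : ℕ → ℝ) : ∏ i ∈ Finset.range 2, q i = q 0 * q 1 := by
  rw [Finset.prod_range_succ, Finset.prod_range_one]

/-- **THEOREM (FAR for every two-plateau block-comb with ONE root block, canonical model).**  Chain gates `q 0, q 1 ∈ [0,1]` with
`x := q 0·q 1 > 0`; all levels `≤ 2`; root blobs (level `0`) of a common gate `ρ ∈ [x, 1]` and total size `≤ j`; level-`1` blobs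
TIED (gate `q 1`, marginal `x`); level-`2` blobs SURE (gate `1`, marginal `x`: the terminal block); budget
`2j < ρ·Σ_{lv = 0} a + x·Σ_{lv ≠ 0} a` (`= EN`).  Then `x ≤ TAIL[2, q, lv, a, g, j] = P(N ≥ j+1)`.  Gate coordinates
(LEAD-NOTES-G10 N21 (0)): one root block `(r ≤ j, ρ)`, any number of tied blobs `(b_k, x/w)` at ONE height `w`, terminal `c` at
`x`, `EN > 2j` ⟹ FAR — core (α) of LEAD-NOTES-G12 N23 (2g) with a single root block, both regimes.  Proof: `ρ·q 0 ≤ x`: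
`tail_ge_of_commonRoot_tied_of_budget`; `x < ρ·q 0`: root contraction (`tail_contract_root`) and the `D = 1` block-star row
`tail_one_ge_rootGate_of_mean` at least marginal `q 1 < ρ` (mean `≥ EN/q 0 > 2j`). [this work] -/
theorem tail_two_ge_of_commonRoot (q : ℕ → ℝ) (hq : ∀ i, 0 ≤ q i ∧ q i ≤ 1) (lv : κ → ℕ) (hlv : ∀ k, lv k ≤ 2)
    (a : κ → ℕ) (g : κ → ℝ) (hg : ∀ k, 0 ≤ g k ∧ g k ≤ 1) (j : ℕ) (ρ : ℝ) (hρ1 : ρ ≤ 1)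
    (hx : 0 < q 0 * q 1) (hxρ : q 0 * q 1 ≤ ρ)
    (hrootg : ∀ k, lv k = 0 → g k = ρ)
    (hroot : ∑ k ∈ Finset.univ.filter (fun k => lv k = 0), a k ≤ j)
    (hmid : ∀ k, lv k = 1 → g k = q 1) (hterm : ∀ k, lv k = 2 → g k = 1)
    (hbudget : (2 * j : ℝ) <
      ρ * ∑ k ∈ Finset.univ.filter (fun k => lv k = 0), (a k : ℝ) +
        (q 0 * q 1) * ∑ k ∈ Finset.univ.filter (fun k => lv k ≠ 0), (a k : ℝ)) :
    q 0 * q 1 ≤ TAIL[1 + 1, q, lv, a, g, j] := by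
  have hq0pos : 0 < q 0 := by
    rcases (hq 0).1.lt_or_eq with h | h
    · exact h
    · rw [← h, zero_mul] at hx; exact absurd hx (lt_irrefl 0)
  -- every blob below the root is tied at `x = q 0 · q 1`
  have htied : ∀ k, 0 < a k → lv k ≠ 0 → (∏ i ∈ Finset.range (lv k), q i) * g k = q 0 * q 1 := by
    intro k _ hk0
    have hk : lv k = 1 ∨ lv k = 2 := by have := hlv k; omega
    rcases hk with h1 | h2
    · rw [h1, Finset.prod_range_one, hmid k h1]
    · rw [h2, prefixProd_two, hterm k h2, mul_one]
  by_cases hreg : ρ * q 0 ≤ q 0 * q 1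
  · -- regime `ρ·q 0 ≤ x`: the tied theorem (all-tied after raising the first gate)
    exact tail_ge_of_commonRoot_tied_of_budget 1 q hq lv a g hg j (fun k _ => hlv k) ρ (q 0 * q 1) hρ1 hxρ hx
      (fun k _ hk0 => hrootg k hk0) hroot htied hreg hbudget
  · -- regime `x < ρ·q 0`, i.e. `q 1 < ρ`: every private gate is at least the last chain gate `q 1`
    have hq1ρ : q 1 < ρ := by
      by_contra h
      push Not at h
      exact hreg (by nlinarith [hq0pos.le])
    have h := tail_ge_of_gates_ge_lastGate 1 q hq lv hlv a g hg j ?_ (fun k hk => hterm k hk) ?_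
    · rwa [prefixProd_two] at h
    · intro k hk
      rcases Nat.lt_or_ge (lv k) 1 with h0 | h1
      · rw [hrootg k (by omega)]; exact hq1ρ.le
      · rw [hmid k (by omega)]
    · -- the mean `Σ a·marginal = ρ·(root mass) + x·(rest)`
      have hEN : ∑ k, (a k : ℝ) * ((∏ i ∈ Finset.range (lv k), q i) * g k) =
          ρ * ∑ k ∈ Finset.univ.filter (fun k => lv k = 0), (a k : ℝ) +
            (q 0 * q 1) * ∑ k ∈ Finset.univ.filter (fun k => lv k ≠ 0), (a k : ℝ) := by
        rw [Finset.sum_filter, Finset.sum_filter, Finset.mul_sum, Finset.mul_sum, ← Finset.sum_add_distrib]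
        refine Finset.sum_congr rfl fun k _ => ?_
        by_cases hk : lv k = 0
        · rw [if_pos hk, if_neg (not_not.2 hk), hk, Finset.prod_range_zero, one_mul, hrootg k hk]; ring
        · rw [if_neg hk, if_pos hk]
          by_cases hak : 0 < a k
          · rw [htied k hak hk]; ring
          · have : a k = 0 := by omega
            rw [this]; simp
      rw [hEN]; exact hbudget

end BlockComb

end Quant

end Summit.CriticalPhenomena.PercolationContinuityZ3.Theorems
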